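import Summits.Parity.GeneralizedHardyLittlewood.Theorems.Dhl42DefsTables
import Summits.Parity.GeneralizedHardyLittlewood.Theorems.Dhl42BigU
import Literature.NumberTheory.Sieve.PolymathBoundedGaps

/-!
# DHL[42,2] certificate — the staircase regions `Ω, Ω'`, the graded regions, the marked trial function `F₀` and the functionals `I, J^K, L_G`

The sentinel fact `bigU_sentinel` for `U_t` (`Dhl42BigU`); the banded staircase regions
`OmegaF ⊆ S·R_42` (`Ω`) and `OmegaG ⊆ K·R_41` (`Ω'`) of Table 2 / Remark 5.4 and the original graded
regions `GradedF`, `GradedG`; the profile `g`, the marked profile `h`, the coefficient vectors, `Φ`,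
`χ`, the marked factor `R` and the trial function `F₀` (Section 7.2); the functionals
`Ival = I(F₀)`, `F0marg = (F₀)₁`, `JKval = J^K(F₀)`, `LGval = L_G` (eqs. (14)–(16)); and the
elementary positivity / smoke facts used downstream (`gfun_pos`, `hfun_*`, `chi_Kc`, `Phi_zero_pos`,
`Rmark_zero`, `F0_zero_pos`, `OmegaF_nonempty`). The simplex is the tree's `scaledSimplex` (Polymath
8b notation `r · R_k`). NOT here: the cover members and bins (→ `Dhl42DefsCover`); integrability of
the integrands (→ `Dhl42Integrability*`).

Origin: the verbatim leg `Dhl42/TpY4Dhl42.lean` of the DHL[42,2] certificate package (pub-dhl42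
bundle, archive blob `18cce9e3`; paper snapshot = `paper/main.tex` v1), lines :844–:946 and
:2384–:2458 (Part 7 lemmas); statements and proofs unchanged except: namespace `TpY4Dhl42` →
`Summit.Parity.GeneralizedHardyLittlewood.Theorems.Dhl42`, the package's `simplexSet n B` replaced
by the tree's definitionally equal `Literature.NumberTheory.Sieve.scaledSimplex n B`
(`PolymathBoundedGaps.lean`), docstrings added where missing; the smoke `example`s and
`denselyDivisible_one_one` of Part 7 are not migrated; `bigU`/`bigU_antitone` (:824–:842) live in
`Dhl42BigU`.

Declarations (28): `bigU_sentinel`, `OmegaF`, `OmegaG`, `GradedF`, `GradedG`, `gfun`, `hfun`,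
`cvec`, `cpvec`, `dvec`, `Phi`, `chi`, `Rmark`, `F0`, `Ival`, `F0marg`, `JKval`, `LGval`,
`gfun_pos`, `gfun_zero`, `hfun_zero`, `hfun_nonneg`, `hfun_lt_one`, `chi_Kc`, `Phi_zero_pos`,
`Rmark_zero`, `F0_zero_pos`, `OmegaF_nonempty`.
-/

open MeasureTheory
open Literature.NumberTheory.Sieve (scaledSimplex)

namespace Summit.Parity.GeneralizedHardyLittlewood.Theorems.Dhl42

noncomputable section

/-- No coordinate of a point of `S·R_42` reaches the sentinel level
`S + ρ₀`, so the mass above it vanishes. -/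
theorem bigU_sentinel {t : Fin 42 → ℝ} (ht : t ∈ scaledSimplex 42 Sc) :
    bigU t (Sc + rho0) = 0 := by
  unfold bigU
  refine Finset.sum_eq_zero fun j _ => ?_
  rw [if_neg]
  intro hle
  have h1 : t j ≤ ∑ i, t i := Finset.single_le_sum (fun i _ => ht.1 i) (Finset.mem_univ j)
  have h2 : (0 : ℝ) < rho0 := by unfold rho0; norm_num
  have := ht.2
  linarith

/-- The reduced (banded) staircase region `Ω ⊂ S·R_42`: Definition 5.2 for
the data (union grid, banded column `g`, `ε_{2,g}`) — for every grade `g`,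
either the point is below the grade-`g` layer or every level constraint of
the band-`g` column holds.  By Remark 5.4 (the banded thresholds being the
band-wise minima, non-increasing in `g` — `tauFband_antitone_band` below)
this is exactly the paper's reduced region of Section 7.1/Table 2. -/
def OmegaF : Set (Fin 42 → ℝ) :=
  {t ∈ scaledSimplex 42 Sc |
    ∀ g : Fin 3, (∑ j, t j) ≤ Sc - eps2 g ∨ ∀ l : Fin 54, bigU t (uvec l) ≤ tauFband g l}

/-- The reduced (banded) region `Ω' ⊂ K·R_41` (thresholds `τ^G`). -/
def OmegaG : Set (Fin 41 → ℝ) :=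
  {t ∈ scaledSimplex 41 Kc |
    ∀ g : Fin 3, (∑ j, t j) ≤ Kc - eps2 g ∨ ∀ l : Fin 54, bigU t (uvec l) ≤ tauGband g l}

/-- The original graded staircase region of Definition 5.2 for the per-grade
data (grades A, B, C with their own levels and thresholds) — the region whose
`ρ₀`-admissibility Proposition 5.3 gives from `staircaseFacts_hold`. -/
def GradedF : Set (Fin 42 → ℝ) :=
  {t ∈ scaledSimplex 42 Sc |
    ((∑ j, t j) ≤ Sc - eps2 0 ∨ ∀ j : Fin 22, bigU t (levA j) ≤ tauFA j) ∧
    ((∑ j, t j) ≤ Sc - eps2 1 ∨ ∀ j : Fin 42, bigU t (levB j) ≤ tauFB j) ∧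
    ((∑ j, t j) ≤ Sc - eps2 2 ∨ ∀ j : Fin 46, bigU t (levC j) ≤ tauFC j)}

/-- The original graded region `⊂ K·R_41` (thresholds `τ^G`). -/
def GradedG : Set (Fin 41 → ℝ) :=
  {t ∈ scaledSimplex 41 Kc |
    ((∑ j, t j) ≤ Kc - eps2 0 ∨ ∀ j : Fin 22, bigU t (levA j) ≤ tauGA j) ∧
    ((∑ j, t j) ≤ Kc - eps2 1 ∨ ∀ j : Fin 42, bigU t (levB j) ≤ tauGB j) ∧
    ((∑ j, t j) ≤ Kc - eps2 2 ∨ ∀ j : Fin 46, bigU t (levC j) ≤ tauGC j)}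

/-- The one-dimensional profile `g(t) = 1 + 3e^{-20t} + 6e^{-80t} + 8e^{-300t}`
(Section 7.2). -/
def gfun (t : ℝ) : ℝ :=
  1 + 3 * Real.exp (-(20 * t)) + 6 * Real.exp (-(80 * t)) + 8 * Real.exp (-(300 * t))

/-- The marked profile `h(t) = 1 - e^{-100t}` (Section 7.2). -/
def hfun (t : ℝ) : ℝ := 1 - Real.exp (-(100 * t))

/-- The coefficients `c_0, ..., c_7` of the radial spline `Φ` (Section 7.2). -/
def cvec : Fin 8 → ℝ :=
  ![334 / 58061, 433 / 99057, 52092 / 66569, 3616 / 82153, 16733 / 92985, 12209 / 81109,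
    393 / 92521, -(11741 / 72527)]

/-- The coefficients `c'_0, c'_1, c'_2` of `Φ` (Section 7.2). -/
def cpvec : Fin 3 → ℝ := ![-(127 / 97438), -(14869 / 80543), -1]

/-- The coefficients `d_0, ..., d_8` of the marked radial spline `χ`
(Section 7.2). -/
def dvec : Fin 9 → ℝ :=
  ![5 / 13987, 1352 / 74209, 1892 / 59563, 4541 / 59847, -(8642 / 45845), 207 / 7447,
    2214 / 23467, 181 / 41985, -(624 / 5405)]

/-- The spline `Φ(s) = Σ_a c_a (S-s)^a + Σ_a c'_a (K-s)_+^a` of eq. (20),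
with the convention `(K-s)_+^0 := 1[s ≤ K]` (paper, after eq. (20)). -/
def Phi (s : ℝ) : ℝ :=
  (∑ a : Fin 8, cvec a * (Sc - s) ^ (a : ℕ)) +
    if s ≤ Kc then ∑ a : Fin 3, cpvec a * (Kc - s) ^ (a : ℕ) else 0

/-- The marked spline `χ(s) = Σ_{a=0}^{8} d_a (K-s)_+^a` of eq. (20), with
the same convention; `χ` is supported in `[0, K]`. -/
def chi (s : ℝ) : ℝ :=
  if s ≤ Kc then ∑ a : Fin 9, dvec a * (Kc - s) ^ (a : ℕ) else 0

/-- The marked ratio `R(t) = Σ_l η(t_l)`, `η := h/g` (Section 6.1; `g > 0`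
everywhere, so `η` is well defined). -/
def Rmark (t : Fin 42 → ℝ) : ℝ := ∑ l, hfun (t l) / gfun (t l)

/-- The marked trial function
`F_0(t) = Π_j g(t_j) · (Φ(Σt) + χ(Σt) R(t))` on `S·R_42`, zero elsewhere
(eq. (12) with the Section-7.2 data). -/
def F0 (t : Fin 42 → ℝ) : ℝ :=
  (scaledSimplex 42 Sc).indicator
    (fun t => (∏ j, gfun (t j)) * (Phi (∑ j, t j) + chi (∑ j, t j) * Rmark t)) t

/-- `I(F_0) = ⟨F_0, F_0⟩` (Lemma 6.1(b)). -/
def Ival : ℝ := ∫ t : Fin 42 → ℝ, F0 t ^ 2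

/-- The first-coordinate marginal `(F_0)_1(t') = ∫ F_0(t_1, t') dt_1` (the
paper's Lemma 6.1(c); by the symmetry of `F_0` it represents every marginal
— a paper-side fact, not needed as a Lean lemma since only `(F_0)_1`
enters the statements). -/
def F0marg (t' : Fin 41 → ℝ) : ℝ := ∫ s : ℝ, F0 (Fin.cons s t')

/-- `J^K(F_0) = ∫_{K·R_41} (F_0)_1(t')² dt'` (Lemma 6.1(c)). -/
def JKval : ℝ := ∫ t' in scaledSimplex 41 Kc, F0marg t' ^ 2

/-- `L_G = ∫_{K·R_41 \ Ω'} (F_0)_1²` (eq. (16)). -/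
def LGval : ℝ := ∫ t' in scaledSimplex 41 Kc \ OmegaG, F0marg t' ^ 2

/-! ### Elementary facts about the trial-function data (package Part 7) -/

/-- Smoke: `g > 0` everywhere. -/
theorem gfun_pos (t : ℝ) : 0 < gfun t := by
  unfold gfun
  positivity

/-- Smoke: `g(0) = 18`. -/
theorem gfun_zero : gfun 0 = 18 := by
  unfold gfun
  norm_num

/-- Smoke: `h(0) = 0` (the marked profile vanishes at the origin). -/
theorem hfun_zero : hfun 0 = 0 := by
  unfold hfun
  norm_num

/-- Smoke: `0 ≤ h(t)` for `t ≥ 0`. -/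
theorem hfun_nonneg {t : ℝ} (ht : 0 ≤ t) : 0 ≤ hfun t := by
  unfold hfun
  have h1 : Real.exp (-(100 * t)) ≤ 1 := by
    rw [← Real.exp_zero]
    exact Real.exp_le_exp.mpr (by linarith)
  linarith

/-- Smoke: `h(t) < 1` for all `t`. -/
theorem hfun_lt_one (t : ℝ) : hfun t < 1 := by
  unfold hfun
  have := Real.exp_pos (-(100 * t))
  linarith

/-- Smoke: `χ(K) = d₀ = 5/13987 > 0`, so the marked radial factor is not
identically zero and the marked coordinate genuinely enters `F_0`. -/
theorem chi_Kc : chi Kc = 5 / 13987 := by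
  unfold chi dvec
  rw [if_pos le_rfl]
  norm_num [Fin.sum_univ_succ]

/-- Smoke: `Φ(0) > 0` (exact rational arithmetic: `Φ(0) = 0.0129…`). -/
theorem Phi_zero_pos : 0 < Phi 0 := by
  unfold Phi cvec cpvec
  rw [if_pos (by unfold Kc eps; norm_num : (0 : ℝ) ≤ Kc)]
  simp [Fin.sum_univ_succ]
  unfold Sc Kc eps
  norm_num

/-- Smoke: `R(0) = 0` (each summand is `h(0)/g(0) = 0/18`). -/
theorem Rmark_zero : Rmark 0 = 0 := by
  unfold Rmark
  simp [hfun_zero]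

/-- Smoke: the marked trial function is strictly positive at the origin
(`F_0(0) = 18⁴² Φ(0)`), so `F_0` does not vanish identically and the
certificate inequality is about a non-degenerate function. -/
theorem F0_zero_pos : 0 < F0 0 := by
  unfold F0
  rw [Set.indicator_of_mem]
  · have h1 : (∑ j : Fin 42, (0 : Fin 42 → ℝ) j) = 0 := by simp
    have h2 : (∏ j : Fin 42, gfun ((0 : Fin 42 → ℝ) j)) = 18 ^ 42 := by
      simp [gfun_zero]
    have h3 : Rmark (0 : Fin 42 → ℝ) = 0 := Rmark_zero
    rw [h1, h2, h3, mul_zero, add_zero]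
    exact mul_pos (by positivity) Phi_zero_pos
  · exact ⟨fun j => le_refl 0, by simp; unfold Sc eps; norm_num⟩

/-- Smoke: the origin lies in the banded staircase region `Ω` (via the deep
alternative of every grade), so `Ω ≠ ∅`. -/
theorem OmegaF_nonempty : (0 : Fin 42 → ℝ) ∈ OmegaF := by
  refine ⟨⟨fun j => le_refl 0, ?_⟩, fun g => Or.inl ?_⟩
  · simp only [Pi.zero_apply, Finset.sum_const_zero]
    unfold Sc eps
    norm_num
  · simp only [Pi.zero_apply, Finset.sum_const_zero]
    match g with
    | 0 => rw [eps2A_eq]; unfold Sc eps; norm_num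
    | 1 => rw [eps2B_eq]; unfold Sc eps; norm_num
    | 2 => rw [eps2C_eq]; unfold Sc eps; norm_num

end

end Summit.Parity.GeneralizedHardyLittlewood.Theorems.Dhl42
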